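import Literature.NumberTheory.EllipticCurves.Kato2004.ZetaBodyLayerValuesTwoProofs
import Literature.NumberTheory.EllipticCurves.Kato2004.EulerSystemIsogenyTransportZeta
import HarnessLib

/-!
# Kato 2004 (Astérisque 295) at `p = 2`, EVERY elliptic curve (reducible `E[2]` included): hypothesis (i) of Thm. 13.4 —
# a non-zero genuine `2`-adic Euler-system class in every pinned `𝐇¹_Γ(T₂W)`, in every analytic rank — modulo the
# MEMBER construction fact `exists_member_eulerSystem_expStar_values` and Rohrlich (THEOREMS ONLY)

Topic `NumberTheory/EllipticCurves`, sub-directory `Kato2004` (namespace = path). THEOREMS ONLY (net debt 0). Cell `bsd-2adic`,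
seat `bsd-2adic-addL2x` (GEN 20; crux stmt-BirchSwinnertonDyer-19098 `AdditiveRankZeroAtTwo`, child C4″ stmt-BirchSwinnertonDyer-22618:
the 41 + 9 split-twist census rows with REDUCIBLE `E[2]`). Companion of `ZetaBodyLayerValuesTwoProofs.lean` (p743751), whose
assembly `exists_isEulerSystemClassTwo_ne_zero_of_rohrlich` displays `W[2]` irreducible because it consumes the irreducible-image
fact `exists_eulerSystem_expStar_values`. Kato's (8.1.3)/Ex. 13.3 carry NO image hypothesis; the tree's MEMBER transcription
`exists_member_eulerSystem_expStar_values` (`EulerSystemValuesMember.lean`: the classes live on an isogenous member `W'` carrying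
Kato's lattice `V_{ℤ_p}(f)(1)`) transported along the isogeny (`forall_exists_zetaBody_of_member`, `EulerSystemIsogenyTransportZeta.lean`)
gives a `ZetaBody` witness for EVERY elliptic `W/ℚ`; §3 of the companion file then applies verbatim.

* `exists_isEulerSystemClassTwo_ne_zero_of_member_of_rohrlich` — for EVERY elliptic `W/ℚ`, newform `f` of `W`, cyclotomic `κ`,
  pin `I`: GRANTED `exists_member_eulerSystem_expStar_values` and Rohrlich for `f` at `2` (hypothesis `hR`, the shape of the kernel
  theorem `PSRohrlichAtLevel.rohrlich_primePow_of_isNewformOf`): `∃ s, IsEulerSystemClassTwo W hκ I s ∧ s ≠ 0`;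
* `nontrivial_iwasawaH1_two_of_member_of_rohrlich`, `one_le_rank_iwasawaH1_two_of_member_of_rohrlich` ((12.2.2) at `p = 2`).

HONEST FRAMING: conditional on the named MEMBER construction fact (def:Prop) and on `hR`; nothing asserted; BSD is not proved by
any of this. [Kato2004Asterisque] Thm. 12.5 (1) pp. 221–222, Ex. 13.3 p. 225, §8.3 p. 181, Thm. 13.4 (i) p. 226;
[RohrlichInventiones1984]; [Wuthrich2014] Prop. 8.
-/

set_option autoImplicit false

noncomputable section

open scoped BigOperators NumberField TensorProduct MatrixGroups
open Field IsDedekindDomain CongruenceSubgroup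
open Literature.NumberTheory.GaloisRepresentations
open Literature.NumberTheory.EllipticCurves Literature.NumberTheory.EllipticCurves.ModularForms
open Literature.NumberTheory.EllipticCurves.Kato2004.EulerSystemValues Rat.HeightOneSpectrum

namespace Literature.NumberTheory.EllipticCurves.Kato2004

variable (W : WeierstrassCurve ℚ) [W.IsElliptic] [ContinuousSMul ℤ_[2] (W.tateModule 2)]
  [Module.Free ℤ_[2] (W.tateModule 2)] [Module.Finite ℤ_[2] (W.tateModule 2)] {κ : ZpExtension ℚ 2}
  {γ : absoluteGaloisGroup ℚ} (I : IwasawaH1Data W 2 κ γ)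

/-- **Hypothesis (i) of Kato Thm. 13.4 at `p = 2` for EVERY elliptic curve (any residual image, any reduction, any analytic
rank), modulo the MEMBER construction fact and Rohrlich.** For `W/ℚ` elliptic, `f` a newform of `W`, `κ` cyclotomic and any pin
`I : IwasawaH1Data W 2 κ γ`: GRANTED `exists_member_eulerSystem_expStar_values` and Rohrlich's finiteness for `f` at `2` (`hR`),
some `s ∈ 𝐇¹_Γ(T₂W)` is a genuine `2`-adic Euler-system class and `s ≠ 0`: a `ZetaBody` witness on `W` itself exists over Kato's
guarded datum (`forall_exists_zetaBody_of_member`, `exists_katoDatum`), its `2`-power line lifts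
(`exists_isEulerSystemClassTwo_of_zetaBody`) and the lift is non-zero (`zetaBody_lift_ne_zero_of_rohrlich_two`).
[cite: Kato2004Asterisque, Ex. 13.3 (p. 225), §8.3 (p. 181), Thm. 12.5 (1) (pp. 221–222), Thm. 13.4 (p. 226)] [cite: Wuthrich2014, Prop. 8 (p. 388)] -/
theorem exists_isEulerSystemClassTwo_ne_zero_of_member_of_rohrlich (hκ : κ.IsCyclotomic)
    (hES : exists_member_eulerSystem_expStar_values) {N : ℕ} [NeZero N] (f : CuspForm (Gamma0 N) 2)
    (hf : IsNewformOf W f)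
    (hR : Set.Finite {χ : Σ m : ℕ, DirichletCharacter ℂ m |
        χ.1 ≠ 0 ∧ χ.1.primeFactors ⊆ {2} ∧ χ.2.IsPrimitive ∧
          ∃ L : ℂ → ℂ, Differentiable ℂ L ∧
            (∀ s : ℂ, 2 < s.re → L s = twistedLSeries f χ.2 s) ∧ L 1 = 0}) :
    ∃ s : I.H, IsEulerSystemClassTwo W hκ I s ∧ s ≠ 0 := by
  set ι : (m : ℕ) → (CyclotomicField m ℚ →+* ℂ) :=
    fun m ↦ Classical.choice (inferInstance : Nonempty (CyclotomicField m ℚ →+* ℂ)) with hι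
  obtain ⟨κ', hκ'0, Λ', hfam⟩ := forall_exists_zetaBody_of_member hES W 2 f hf ι
  obtain ⟨c, d, a, A, hA, hc, hd, hcA, hdA, hc1, hd1, ha⟩ := exists_katoDatum f hf.1 hf.coeffField_eq_bot 2
  obtain ⟨z, x, hbody⟩ := hfam c d a A hA hc hd
  have hne := two_mul_natAbs_ne_zero_of_guards 2 hA (NeZero.ne N) hc hd
  obtain ⟨y, hyES, hy⟩ := exists_isEulerSystemClassTwo_of_zetaBody W hκ I f ι κ' Λ' c d a A z x hbody hne
  exact ⟨y, hyES, zetaBody_lift_ne_zero_of_rohrlich_two hbody hf hκ'0 hA hc hd hcA hdA hc1 hd1 ha hκ hy hR⟩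

/-- **`𝐇¹_Γ(T₂W) ≠ 0` for EVERY elliptic `W/ℚ`** (`κ` cyclotomic, any pin), modulo the member construction fact and Rohrlich
for the newform of `W` at `2`. [cite: Kato2004Asterisque, Thm. 12.5 (1) (pp. 221–222), Prop. 13.7 (p. 227)] -/
theorem nontrivial_iwasawaH1_two_of_member_of_rohrlich (hκ : κ.IsCyclotomic)
    (hES : exists_member_eulerSystem_expStar_values) {N : ℕ} [NeZero N] (f : CuspForm (Gamma0 N) 2)
    (hf : IsNewformOf W f)
    (hR : Set.Finite {χ : Σ m : ℕ, DirichletCharacter ℂ m |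
        χ.1 ≠ 0 ∧ χ.1.primeFactors ⊆ {2} ∧ χ.2.IsPrimitive ∧
          ∃ L : ℂ → ℂ, Differentiable ℂ L ∧
            (∀ s : ℂ, 2 < s.re → L s = twistedLSeries f χ.2 s) ∧ L 1 = 0}) :
    Nontrivial I.H := by
  obtain ⟨s, -, hs⟩ := exists_isEulerSystemClassTwo_ne_zero_of_member_of_rohrlich W I hκ hES f hf hR
  exact nontrivial_of_ne s 0 hs

/-- **`1 ≤ rank_Λ 𝐇¹_Γ(T₂W)` for EVERY elliptic `W/ℚ`** — (12.2.2) at `p = 2` — `κ` cyclotomic with topological generator `γ`,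
any pin, modulo the member construction fact and Rohrlich for the newform of `W` at `2`.
[cite: Kato2004Asterisque, §12.2 (12.2.2) (p. 220), Thm. 12.4 (2) (p. 221), Thm. 12.5 (1) (pp. 221–222)] -/
theorem one_le_rank_iwasawaH1_two_of_member_of_rohrlich (hκ : κ.IsCyclotomic) (hγ : κ.IsTopGenerator γ)
    (hES : exists_member_eulerSystem_expStar_values) {N : ℕ} [NeZero N] (f : CuspForm (Gamma0 N) 2)
    (hf : IsNewformOf W f)
    (hR : Set.Finite {χ : Σ m : ℕ, DirichletCharacter ℂ m |
        χ.1 ≠ 0 ∧ χ.1.primeFactors ⊆ {2} ∧ χ.2.IsPrimitive ∧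
          ∃ L : ℂ → ℂ, Differentiable ℂ L ∧
            (∀ s : ℂ, 2 < s.re → L s = twistedLSeries f χ.2 s) ∧ L 1 = 0}) :
    1 ≤ Module.rank (IwasawaAlgebra 2) I.H := by
  haveI := nontrivial_iwasawaH1_two_of_member_of_rohrlich W I hκ hES f hf hR
  exact one_le_rank_iwasawaH1_of_nontrivial hγ I

end Literature.NumberTheory.EllipticCurves.Kato2004

end
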